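import Summits.Ventures.Crystal3D.Theorems.StickyWulffConstantTextureBuildCoverageCuts
import Summits.Ventures.Crystal3D.Theorems.StickyWulffConstantTextureBuildSlabPieces
import Summits.Ventures.Crystal3D.Theorems.StickyWulffConstantPolycrystalWulffBoundHyperplaneNull
import Summits.Ventures.Crystal3D.Theorems.StickyWulffConstantPolycrystalWulffBoundCoherentTwinEquality
import HarnessLib

/-!
# TB-D assembly, part 10: the CUT LEVEL of a prism texture-cell — Cavalieri with the slice excess
# (lane T, crux `TextureLiminfV5`, stmt-Ventures-23912; repair census HOME/wulff-p2/g20/TB-D-1-g20.md §2 (C3); brick B5)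

HONEST FRAMING. Venture `Summits/Ventures/Crystal3D` (cell `crystal3d-full`), route `route-Ventures-StickyWulffConstant`, helper `--supports` the
law-v5 crux `TextureLiminfV5` (stmt-Ventures-23912).  Pure measure theory (census-free, standard axioms): the choice of the height `τ ∈ (0,1)` at
which the prism texture-cell of a wall cell is cut into its bottom (grain `fk`) and top (grain `gk`) halves.  Nothing about the wall law; F-C1 not moved.

SETTING (actual position).  `P = polytope HP` the prism (bounded); unit normal `n` of the cell's horizontal planes and base level `h₀` (model height
`= ⟪n, y⟫ − h₀`); `D ⊆ cl P` the placed DISC SLICE of the law (model `wallSlice ρ`, heights `[0,1]`, `volume D = πρ²`); the SLICE EXCESS hypothesis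
`volume (P ∩ {0 ≤ height ≤ 1}) ≤ πρ² + ex` (`Mesh₃.hex`); the two slab families `laySlab L₁ s₁ ·`, `laySlab L₂ s₂ ·` of the bottom / top grain; a table
`0 ≤ c i j ≤ 13/25` whose partial sums against the disc slice are bounded by `charge` (`Σ_{(i,j) ∈ F} c·vol (D ∩ slab¹_i ∩ slab²_j) ≤ charge`, all finite `F`).
CONCLUSION (`exists_cut_level`).  Some `τ ∈ (0,1)` has, for EVERY finite index set `F`,
  `Σ_{(i,j) ∈ F} c i j · facetArea (cl P ∩ cl slab¹_i ∩ cl slab²_j ∩ {⟪n, y⟫ = h₀ + τ}) n ≤ charge + (13/25)·ex`.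
PROOF.  Cavalieri on the finitely many slab pairs meeting `cl P` (`exists_level_sum_facetArea_le`, p711559): the level cost is at most the `c`-weighted volume of
`cl P ∩ {h₀ < ⟪n,·⟫ < h₀ + 1}` split along the slab pairs; that volume splits into the part inside `D` (`≤ charge`, closures of slabs and of `P` being a.e. the open
sets) and the part outside `D`, whose slab pieces are a.e. disjoint, so it contributes `≤ (13/25)·(vol (P ∩ slice) − πρ²) ≤ (13/25)·ex`.
-/

noncomputable section

namespace Summit.Ventures.Crystal3D.Cruxes.TextureLiminf.TexShadow

open Summit.Ventures.Crystal3D Summit.Ventures.Crystal3D.Theorems MeasureTheory Set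
open Summit.Ventures.Crystal3D.TentCertificate (height hB hB_pos mem_laySlab_iff isOpen_laySlab disjoint_laySlab)
open scoped InnerProductSpace ENNReal

/-! ### Closures are a.e. the open sets -/

/-- The closure of a layer slab is a.e. the slab (the two bounding layer planes are null). -/
theorem closure_laySlab_ae_eq (L : E3 ≃ₗᵢ[ℝ] E3) (s : E3) (i : ℤ) : closure (laySlab L s i) =ᵐ[volume] laySlab L s i := by
  refine (ae_eq_set).2 ⟨?_, measure_mono_null (fun y hy => absurd (subset_closure hy.1) hy.2) measure_empty⟩
  have hsub : closure (laySlab L s i) \ laySlab L s i ⊆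
      {y : E3 | ⟪L e₃, y⟫_ℝ = (i : ℝ) * hB + ⟪L e₃, s⟫_ℝ} ∪ {y : E3 | ⟪L e₃, y⟫_ℝ = ((i : ℝ) + 1) * hB + ⟪L e₃, s⟫_ℝ} := by
    rintro y ⟨hyc, hyn⟩
    have hc := closure_laySlab_subset L s i hyc
    rw [mem_laySlab_iff] at hyn
    simp only [mem_setOf_eq, not_and_or, not_lt] at hc hyn
    rw [height_eq_inner] at hc hyn
    rcases hyn with h | h
    · left; simp only [mem_setOf_eq]; linarith [hc.1]
    · right; simp only [mem_setOf_eq]; linarith [hc.2]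
  have hne : L e₃ ≠ 0 := fun h => by have := norm_frame_e₃ L; rw [h, norm_zero] at this; exact zero_ne_one this
  exact measure_mono_null hsub (measure_union_null (volume_setOf_inner_eq_zero hne _) (volume_setOf_inner_eq_zero hne _))

/-- The closure of a piece with nonzero normals is a.e. the piece. -/
theorem closure_polytope_ae_eq (H : Finset (E3 × ℝ)) (hH : ∀ p ∈ H, p.1 ≠ 0) : closure (polytope H) =ᵐ[volume] polytope H := by
  refine (ae_eq_set).2 ⟨?_, measure_mono_null (fun y hy => absurd (subset_closure hy.1) hy.2) measure_empty⟩
  have hcl : closure (polytope H) ⊆ ⋂ p ∈ H, {x : E3 | ⟪p.1, x⟫_ℝ ≤ p.2} :=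
    closure_minimal (fun y hy => by
      simp only [polytope, mem_iInter, mem_setOf_eq] at hy ⊢
      exact fun p hp => (hy p hp).le)
      (isClosed_biInter fun p _ => isClosed_le (continuous_const.inner continuous_id) continuous_const)
  have hsub : closure (polytope H) \ polytope H ⊆ (⋂ p ∈ H, {x : E3 | ⟪p.1, x⟫_ℝ ≤ p.2}) \ ⋂ p ∈ H, {x : E3 | ⟪p.1, x⟫_ℝ < p.2} :=
    fun y hy => ⟨hcl hy.1, hy.2⟩
  exact measure_mono_null hsub (volume_hPolyhedron_closed_diff_open H hH)

/-- Intersections with a.e.-equal sets have equal volume (convenience form). -/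
theorem volume_inter_congr_ae {A B B' : Set E3} (h : B =ᵐ[volume] B') : volume (A ∩ B) = volume (A ∩ B') :=
  measure_congr ((ae_eq_refl A).inter h)

/-! ### The cut level -/

/-- **THE CUT LEVEL** (see the module docstring). -/
theorem exists_cut_level {n : E3} (hn : ‖n‖ = 1) (h₀ : ℝ) (HP : Finset (E3 × ℝ)) (hPbd : Bornology.IsBounded (polytope HP))
    (hPunit : ∀ p ∈ HP, ‖p.1‖ = 1)
    {D : Set E3} (hDm : MeasurableSet D) (hDP : D ⊆ closure (polytope HP))
    (hDsl : D ⊆ {y : E3 | h₀ ≤ ⟪n, y⟫_ℝ ∧ ⟪n, y⟫_ℝ ≤ h₀ + 1}) {ρ ex : ℝ}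
    (hDvol : volume D = ENNReal.ofReal (Real.pi * ρ ^ 2))
    (hex : (volume (polytope HP ∩ {y : E3 | h₀ ≤ ⟪n, y⟫_ℝ ∧ ⟪n, y⟫_ℝ ≤ h₀ + 1})).toReal ≤ Real.pi * ρ ^ 2 + ex)
    (L₁ L₂ : E3 ≃ₗᵢ[ℝ] E3) (s₁ s₂ : E3) (c : ℤ → ℤ → ℝ) (hc0 : ∀ i j, 0 ≤ c i j) (hc1 : ∀ i j, c i j ≤ 13 / 25)
    {charge : ℝ} (hcharge : ∀ F : Finset (ℤ × ℤ),
      ∑ ij ∈ F, c ij.1 ij.2 * (volume (D ∩ laySlab L₁ s₁ ij.1 ∩ laySlab L₂ s₂ ij.2)).toReal ≤ charge) :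
    ∃ τ ∈ Set.Ioo (0 : ℝ) 1, ∀ F : Finset (ℤ × ℤ),
      ∑ ij ∈ F, c ij.1 ij.2 * facetArea (closure (polytope HP) ∩ closure (laySlab L₁ s₁ ij.1) ∩ closure (laySlab L₂ s₂ ij.2) ∩
        {y : E3 | ⟪n, y⟫_ℝ = h₀ + τ}) n ≤ charge + 13 / 25 * ex := by
  classical
  -- the slab-pair pieces of the closed prism
  set S : ℤ × ℤ → Set E3 := fun ij => closure (polytope HP) ∩ closure (laySlab L₁ s₁ ij.1) ∩ closure (laySlab L₂ s₂ ij.2) with hS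
  have hSm : ∀ ij, MeasurableSet (S ij) := fun ij =>
    (isClosed_closure.inter isClosed_closure).measurableSet.inter isClosed_closure.measurableSet
  have hSb : ∀ ij, Bornology.IsBounded (S ij) := fun ij => (hPbd.closure.subset inter_subset_left).subset inter_subset_left
  have hSsub : ∀ ij, S ij ⊆ closure (polytope HP) := fun ij x hx => hx.1.1
  -- the finitely many slabs whose closure meets the closed prism
  set B : Set E3 := Metric.thickening 1 (closure (polytope HP)) with hB
  have hBbd : Bornology.IsBounded B := hPbd.closure.thickening
  have hfin₁ := finite_slabs_meeting L₁ s₁ hBbd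
  have hfin₂ := finite_slabs_meeting L₂ s₂ hBbd
  have hmeet : ∀ (L : E3 ≃ₗᵢ[ℝ] E3) (s : E3) (i : ℤ), (closure (laySlab L s i) ∩ closure (polytope HP)).Nonempty →
      (laySlab L s i ∩ B).Nonempty := by
    rintro L s i ⟨y, hyc, hyP⟩
    obtain ⟨y', hy', hd⟩ := Metric.mem_closure_iff.1 hyc 1 one_pos
    exact ⟨y', hy', Metric.mem_thickening_iff.2 ⟨y, hyP, by rw [dist_comm]; exact hd⟩⟩
  set F₀ : Finset (ℤ × ℤ) := hfin₁.toFinset ×ˢ hfin₂.toFinset with hF₀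
  have hS_empty : ∀ ij, ij ∉ F₀ → S ij = ∅ := by
    intro ij hij
    refine Set.eq_empty_of_forall_notMem fun y hy => hij ?_
    rw [hF₀, Finset.mem_product, Set.Finite.mem_toFinset, Set.Finite.mem_toFinset]
    exact ⟨hmeet L₁ s₁ ij.1 ⟨y, hy.1.2, hy.1.1⟩, hmeet L₂ s₂ ij.2 ⟨y, hy.2, hy.1.1⟩⟩
  -- Cavalieri on `F₀`
  obtain ⟨t, ht, hlev⟩ := exists_level_sum_facetArea_le hn F₀ (fun ij => c ij.1 ij.2) (fun ij _ => hc0 _ _) S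
    (fun ij _ => hSm ij) (fun ij _ => hSb ij) (a := h₀) (b := h₀ + 1) (by linarith)
  rw [show h₀ + 1 - h₀ = (1 : ℝ) by ring, div_one] at hlev
  refine ⟨t - h₀, ⟨by linarith [ht.1], by linarith [ht.2]⟩, fun F => ?_⟩
  rw [show h₀ + (t - h₀) = t by ring]
  -- reduce an arbitrary `F` to `F₀`
  have hfa0 : ∀ (A : Set E3) (ν : E3), 0 ≤ facetArea A ν := fun _ _ => ENNReal.toReal_nonneg
  have hterm0 : ∀ ij, ij ∉ F₀ → c ij.1 ij.2 * facetArea (S ij ∩ {y : E3 | ⟪n, y⟫_ℝ = t}) n = 0 := by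
    intro ij hij
    rw [hS_empty ij hij, Set.empty_inter, facetArea_empty, mul_zero]
  have hF : ∑ ij ∈ F, c ij.1 ij.2 * facetArea (S ij ∩ {y : E3 | ⟪n, y⟫_ℝ = t}) n ≤
      ∑ ij ∈ F₀, c ij.1 ij.2 * facetArea (S ij ∩ {y : E3 | ⟪n, y⟫_ℝ = t}) n := by
    rw [← Finset.sum_filter_add_sum_filter_not F (fun ij => ij ∈ F₀)]
    have h2 : ∑ ij ∈ F.filter (fun ij => ij ∉ F₀), c ij.1 ij.2 * facetArea (S ij ∩ {y : E3 | ⟪n, y⟫_ℝ = t}) n = 0 :=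
      Finset.sum_eq_zero fun ij hij => hterm0 ij (Finset.mem_filter.1 hij).2
    rw [h2, add_zero]
    exact Finset.sum_le_sum_of_subset_of_nonneg (fun ij hij => (Finset.mem_filter.1 hij).2)
      fun ij _ _ => mul_nonneg (hc0 _ _) (hfa0 _ _)
  refine hF.trans (hlev.trans ?_)
  -- the volume side: split along `D`
  set slice : Set E3 := {y : E3 | h₀ < ⟪n, y⟫_ℝ ∧ ⟪n, y⟫_ℝ < h₀ + 1} with hslice
  set cslice : Set E3 := {y : E3 | h₀ ≤ ⟪n, y⟫_ℝ ∧ ⟪n, y⟫_ℝ ≤ h₀ + 1} with hcslice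
  have hslice_sub : slice ⊆ cslice := fun y hy => ⟨hy.1.le, hy.2.le⟩
  have hcsm : MeasurableSet cslice := by
    rw [hcslice, setOf_and]
    exact (isClosed_le continuous_const (continuous_const.inner continuous_id)).measurableSet.inter
      (isClosed_le (continuous_const.inner continuous_id) continuous_const).measurableSet
  set E : Set E3 := (closure (polytope HP) ∩ cslice) \ D with hE
  have hEm : MeasurableSet E := (isClosed_closure.measurableSet.inter hcsm).diff hDm
  -- finiteness of all volumes involved (inside the bounded closed prism)
  have hPfin : volume (closure (polytope HP)) ≠ ⊤ := hPbd.closure.measure_lt_top.ne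
  have hfin : ∀ A : Set E3, A ⊆ closure (polytope HP) → volume A ≠ ⊤ := fun A hA => (measure_mono hA |>.trans_lt hPbd.closure.measure_lt_top).ne
  -- termwise split: `vol (S ij ∩ slice) ≤ vol (D ∩ slabs) + vol (E ∩ slabs)`
  have hsplit : ∀ ij, (volume (S ij ∩ slice)).toReal ≤
      (volume (D ∩ laySlab L₁ s₁ ij.1 ∩ laySlab L₂ s₂ ij.2)).toReal + (volume (E ∩ laySlab L₁ s₁ ij.1 ∩ laySlab L₂ s₂ ij.2)).toReal := by
    intro ij
    -- replace closed slabs by open ones (a.e.)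
    have hae : (volume (S ij ∩ slice)) = volume ((closure (polytope HP) ∩ slice) ∩ laySlab L₁ s₁ ij.1 ∩ laySlab L₂ s₂ ij.2) := by
      have e1 : S ij ∩ slice = ((closure (polytope HP) ∩ slice) ∩ closure (laySlab L₁ s₁ ij.1)) ∩ closure (laySlab L₂ s₂ ij.2) := by
        ext y; simp only [hS, mem_inter_iff]; tauto
      rw [e1, volume_inter_congr_ae (closure_laySlab_ae_eq L₂ s₂ ij.2)]
      have e2 : ((closure (polytope HP) ∩ slice) ∩ closure (laySlab L₁ s₁ ij.1)) ∩ laySlab L₂ s₂ ij.2 =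
          ((closure (polytope HP) ∩ slice) ∩ laySlab L₂ s₂ ij.2) ∩ closure (laySlab L₁ s₁ ij.1) := by
        ext y; simp only [mem_inter_iff]; tauto
      rw [e2, volume_inter_congr_ae (closure_laySlab_ae_eq L₁ s₁ ij.1)]
      congr 1; ext y; simp only [mem_inter_iff]; tauto
    have hsub : (closure (polytope HP) ∩ slice) ∩ laySlab L₁ s₁ ij.1 ∩ laySlab L₂ s₂ ij.2 ⊆
        (D ∩ laySlab L₁ s₁ ij.1 ∩ laySlab L₂ s₂ ij.2) ∪ (E ∩ laySlab L₁ s₁ ij.1 ∩ laySlab L₂ s₂ ij.2) := by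
      rintro y ⟨⟨⟨hyP, hysl⟩, hy1⟩, hy2⟩
      by_cases hyD : y ∈ D
      · exact Or.inl ⟨⟨hyD, hy1⟩, hy2⟩
      · exact Or.inr ⟨⟨⟨⟨hyP, hslice_sub hysl⟩, hyD⟩, hy1⟩, hy2⟩
    rw [hae, ← ENNReal.toReal_add (hfin _ (fun y hy => hDP hy.1.1)) (hfin _ (fun y hy => hy.1.1.1.1))]
    exact ENNReal.toReal_mono (ENNReal.add_ne_top.2 ⟨hfin _ (fun y hy => hDP hy.1.1), hfin _ (fun y hy => hy.1.1.1.1)⟩)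
      ((measure_mono hsub).trans (measure_union_le _ _))
  -- the `D` part is the charge
  have hDpart : ∑ ij ∈ F₀, c ij.1 ij.2 * (volume (D ∩ laySlab L₁ s₁ ij.1 ∩ laySlab L₂ s₂ ij.2)).toReal ≤ charge := hcharge F₀
  -- the `E` part: slab pieces of `E` are disjoint, weights ≤ 13/25, and `vol E ≤ ex`
  have hEvol : (volume E).toReal ≤ ex := by
    have hDfin : volume D ≠ ⊤ := by rw [hDvol]; exact ENNReal.ofReal_ne_top
    have hDsub : D ⊆ closure (polytope HP) ∩ cslice := fun y hy => ⟨hDP hy, hDsl hy⟩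
    have hunion : E ∪ D = closure (polytope HP) ∩ cslice := by
      rw [hE, Set.sdiff_union_of_subset hDsub]
    have h1 : volume (closure (polytope HP) ∩ cslice) = volume E + volume D := by
      rw [← hunion]; exact measure_union disjoint_sdiff_left hDm
    have h2 : volume (closure (polytope HP) ∩ cslice) = volume (polytope HP ∩ cslice) := by
      have := closure_polytope_ae_eq HP (fun p hp h0 => by have := hPunit p hp; rw [h0, norm_zero] at this; exact zero_ne_one this)
      exact measure_congr (this.inter (ae_eq_refl _))
    have hEfin : volume E ≠ ⊤ := hfin _ (fun y hy => hy.1.1)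
    have h3 : (volume (closure (polytope HP) ∩ cslice)).toReal = (volume E).toReal + (volume D).toReal := by
      rw [h1, ENNReal.toReal_add hEfin hDfin]
    rw [h2, hDvol, ENNReal.toReal_ofReal (by positivity)] at h3
    linarith
  have hEpart : ∑ ij ∈ F₀, c ij.1 ij.2 * (volume (E ∩ laySlab L₁ s₁ ij.1 ∩ laySlab L₂ s₂ ij.2)).toReal ≤ 13 / 25 * ex := by
    have h1 : ∑ ij ∈ F₀, c ij.1 ij.2 * (volume (E ∩ laySlab L₁ s₁ ij.1 ∩ laySlab L₂ s₂ ij.2)).toReal ≤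
        ∑ ij ∈ F₀, 13 / 25 * (volume (E ∩ laySlab L₁ s₁ ij.1 ∩ laySlab L₂ s₂ ij.2)).toReal :=
      Finset.sum_le_sum fun ij _ => mul_le_mul_of_nonneg_right (hc1 _ _) ENNReal.toReal_nonneg
    refine h1.trans ?_
    rw [← Finset.mul_sum]
    refine mul_le_mul_of_nonneg_left ?_ (by norm_num)
    -- disjoint pieces of `E`
    have hdisj : ∀ ij ∈ F₀, ∀ ij' ∈ F₀, ij ≠ ij' →
        Disjoint (E ∩ laySlab L₁ s₁ ij.1 ∩ laySlab L₂ s₂ ij.2) (E ∩ laySlab L₁ s₁ ij'.1 ∩ laySlab L₂ s₂ ij'.2) := by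
      intro ij _ ij' _ hne
      by_cases h1 : ij.1 = ij'.1
      · have h2 : ij.2 ≠ ij'.2 := fun h => hne (Prod.ext h1 h)
        exact (disjoint_laySlab L₂ s₂ h2).mono inter_subset_right inter_subset_right
      · exact (disjoint_laySlab L₁ s₁ h1).mono (inter_subset_left.trans inter_subset_right) (inter_subset_left.trans inter_subset_right)
    have hmeas : ∀ ij ∈ F₀, MeasurableSet (E ∩ laySlab L₁ s₁ ij.1 ∩ laySlab L₂ s₂ ij.2) := fun ij _ =>
      (hEm.inter (isOpen_laySlab _ _ _).measurableSet).inter (isOpen_laySlab _ _ _).measurableSet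
    rw [← ENNReal.toReal_sum (fun ij _ => hfin _ (fun y hy => hy.1.1.1.1)), ← measure_biUnion_finset hdisj hmeas]
    exact (ENNReal.toReal_mono (hfin E (fun y hy => hy.1.1))
      (measure_mono (iUnion₂_subset fun ij _ => inter_subset_left.trans inter_subset_left))).trans hEvol
  -- assemble
  calc ∑ ij ∈ F₀, c ij.1 ij.2 * (volume (S ij ∩ slice)).toReal
      ≤ ∑ ij ∈ F₀, c ij.1 ij.2 * ((volume (D ∩ laySlab L₁ s₁ ij.1 ∩ laySlab L₂ s₂ ij.2)).toReal +
          (volume (E ∩ laySlab L₁ s₁ ij.1 ∩ laySlab L₂ s₂ ij.2)).toReal) :=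
        Finset.sum_le_sum fun ij _ => mul_le_mul_of_nonneg_left (hsplit ij) (hc0 _ _)
    _ = (∑ ij ∈ F₀, c ij.1 ij.2 * (volume (D ∩ laySlab L₁ s₁ ij.1 ∩ laySlab L₂ s₂ ij.2)).toReal) +
          ∑ ij ∈ F₀, c ij.1 ij.2 * (volume (E ∩ laySlab L₁ s₁ ij.1 ∩ laySlab L₂ s₂ ij.2)).toReal := by
        rw [← Finset.sum_add_distrib]; exact Finset.sum_congr rfl fun ij _ => mul_add _ _ _
    _ ≤ charge + 13 / 25 * ex := add_le_add hDpart hEpart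

end Summit.Ventures.Crystal3D.Cruxes.TextureLiminf.TexShadow

end
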